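import Mathlib
import Summits.QuantumFields.YangMills.Theorems.FemtoTransferGap
import Literature.Probability.Independence.HoeffdingDecompositionTransport
import Literature.MathematicalPhysics.QuantumFieldTheory.Balaban1983to89.B10Eq18SigmaSU2Haar
import HarnessLib

/-!
# Transport-field regularity kit, brick 1: flow invariance of the configuration measure and `∫ X(G) = 0`
# (support for `CovariantCurrentDoor.CurrentStatePhysical` stmt-QuantumFields-23381 and `TransportFieldFano.RobertsonInequality` 23355)

Routes `TransportFieldFano` / `CovariantCurrentDoor` (LINES g17-A/B of seat ym-idea-4; critic #93 P2 asks for a shared kit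
`Theorems/TransportField*`).  The transport field acts on a direction-0 link `e` by the right translation `U e ↦ U e · expPauli(t·b(U))` with a
direction `b(U)` that is BLIND to the link `e` itself.  This brick proves the two measure-theoretic facts every use of `X` needs, with no
differentiability theory of the vacuum:

* §1 `integral_deriv_eq_zero_of_invariant` — abstract: if `∫ H t dμ` does not depend on `t`, the difference quotients of `t ↦ H t a` at `0`
  are uniformly bounded and the derivative exists pointwise, then `∫ deriv (H · a) 0 dμ = 0` (dominated convergence along `t = 1/(n+1)`).
* §2 `integral_comp_update_mul_right_of_blind` — on a product of Haar probability measures, `∫ F(x[b ↦ x_b · g(x)]) = ∫ F` whenever `g` is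
  measurable and blind to the coordinate `b` (fibrewise right invariance of Haar; Hoeffding averaging operator `condAvg`); specialised to the
  femto configuration measure in `integral_configMeasure_comp_update_mul_right`.
* §3 `integral_deriv_flow_eq_zero` — combination for the transport flow `t ↦ U[e ↦ U e · expPauli(t·b(U))]`.

HONEST FRAMING: measure-theoretic bookkeeping; the C¹-regularity of the vacuum along right translations (the other half of the kit) is NOT here;
no crux, K2a, R2ξ″ or the YM mass gap is proved.  No `sorry`, no new axiom, no new definition.
References: [cite: ReedSimonIV1978, Thm. XIII.1]; [cite: EfronStein1981, §2].
-/

set_option autoImplicit false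

noncomputable section

open MeasureTheory Filter Topology Real Function
open Literature.MathematicalPhysics.QuantumFieldTheory (GaugeConfig Site Edge haarProbability)
open Literature.MathematicalPhysics.QuantumFieldTheory.Balaban1983to89.B10Eq18SigmaSU2Haar (expPauli measurable_expPauli)
open Literature.Probability.Independence.Hoeffding

namespace Summit.QuantumFields.YangMills.Theorems.TransportField

open Summit.QuantumFields.YangMills.Theorems.FemtoTransferGap

/-! ## §1 Invariant integrals have zero integrated derivative -/

/-- ★ **Invariant families have zero integrated derivative.**  `μ` finite; `H : ℝ → α → ℝ` with `∫ H t = ∫ H 0` for all `t`, each `H t`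
measurable, `|H t a − H 0 a| ≤ M|t|` (uniform Lipschitz at `0`) and `t ↦ H t a` differentiable at `0` for every `a`.  Then
`∫ deriv (fun t => H t a) 0 dμ = 0`. [cite: ReedSimonIV1978, Thm. XIII.1] -/
theorem integral_deriv_eq_zero_of_invariant {α : Type*} [MeasurableSpace α] (μ : Measure α) [IsFiniteMeasure μ]
    {H : ℝ → α → ℝ} (hinv : ∀ t, ∫ a, H t a ∂μ = ∫ a, H 0 a ∂μ) (hm : ∀ t, Measurable (H t))
    {C : ℝ} (hb : ∀ t a, |H t a| ≤ C) {M : ℝ} (hLip : ∀ t a, |H t a - H 0 a| ≤ M * |t|)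
    (hd : ∀ a, DifferentiableAt ℝ (fun t => H t a) 0) :
    ∫ a, deriv (fun t => H t a) 0 ∂μ = 0 := by
  -- difference quotients along `tₙ = 1/(n+1)`
  set q : ℕ → α → ℝ := fun n a => (H (1 / ((n : ℝ) + 1)) a - H 0 a) / (1 / ((n : ℝ) + 1)) with hq
  have hint : ∀ t, Integrable (H t) μ := fun t =>
    ⟨(hm t).aestronglyMeasurable, HasFiniteIntegral.of_bounded (C := C)
      (ae_of_all _ fun a => by rw [Real.norm_eq_abs]; exact hb t a)⟩
  have hq0 : ∀ n, ∫ a, q n a ∂μ = 0 := by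
    intro n
    have hn : (0 : ℝ) < 1 / ((n : ℝ) + 1) := by positivity
    rw [hq]; dsimp only
    rw [integral_div, integral_sub (hint _) (hint 0), hinv, sub_self, zero_div]
  -- pointwise convergence to the derivative
  have hlim : ∀ a, Tendsto (fun n => q n a) atTop (𝓝 (deriv (fun t => H t a) 0)) := by
    intro a
    have hda := (hd a).hasDerivAt
    have hs := hda.tendsto_slope_zero
    have hseq : Tendsto (fun n : ℕ => 1 / ((n : ℝ) + 1)) atTop (𝓝[≠] 0) := by
      refine tendsto_nhdsWithin_iff.2 ⟨tendsto_one_div_add_atTop_nhds_zero_nat, Filter.Eventually.of_forall fun n => ?_⟩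
      exact (one_div_pos.2 (by positivity : (0 : ℝ) < (n : ℝ) + 1)).ne'
    have h := hs.comp hseq
    refine h.congr fun n => ?_
    rw [hq]; dsimp only
    rw [Function.comp_apply, zero_add, smul_eq_mul]
    ring
  -- domination
  have hdom : ∀ n, ∀ᵐ a ∂μ, ‖q n a‖ ≤ M := by
    intro n
    refine ae_of_all _ fun a => ?_
    have hn : (0 : ℝ) < 1 / ((n : ℝ) + 1) := by positivity
    rw [Real.norm_eq_abs, hq]; dsimp only
    rw [abs_div, abs_of_pos hn, div_le_iff₀ hn]
    have h := hLip (1 / ((n : ℝ) + 1)) a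
    rwa [abs_of_pos hn] at h
  have hqm : ∀ n, AEStronglyMeasurable (q n) μ := fun n =>
    (((hm _).sub (hm 0)).div_const _).aestronglyMeasurable
  have hDCT := tendsto_integral_of_dominated_convergence (fun _ => M) hqm (integrable_const M) hdom (ae_of_all _ hlim)
  simp only [hq0] at hDCT
  exact tendsto_nhds_unique hDCT tendsto_const_nhds

/-! ## §2 Fibrewise right invariance of a product of Haar measures -/

section Haar

variable {ι : Type*} [Fintype ι] [DecidableEq ι]
variable {G : Type*} [Group G] [TopologicalSpace G] [IsTopologicalGroup G] [CompactSpace G] [MeasurableSpace G] [BorelSpace G]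
  [SecondCountableTopology G]

omit [Fintype ι] [CompactSpace G] in
/-- The fibrewise right translation `x ↦ x[b ↦ x_b · g(x)]` by a `b`-blind measurable `g` is measurable. [folklore] -/
theorem measurable_update_mul_right_of_blind (b : ι) {g : (ι → G) → G} (hg : Measurable g) :
    Measurable fun x : ι → G => Function.update x b (x b * g x) := by
  refine measurable_pi_iff.2 fun i => ?_
  by_cases hi : i = b
  · subst hi; simp only [Function.update_self]; exact (measurable_pi_apply i).mul hg
  · simp only [Function.update_of_ne hi]; exact measurable_pi_apply i

/-- ★ **Fibrewise right invariance**: `∫ F(x[b ↦ x_b · g(x)]) dμ^{⊗ι} = ∫ F dμ^{⊗ι}` for the product of Haar probability measures, bounded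
measurable `F`, and a measurable `g` blind to the coordinate `b` (`g(x[b ↦ y]) = g(x)`).  (Integrate `x_b` out first: right invariance of
Haar.) [cite: EfronStein1981, §2] -/
theorem integral_comp_update_mul_right_of_blind (b : ι) {g : (ι → G) → G} (hg : Measurable g)
    (hblind : ∀ (x : ι → G) (y : G), g (Function.update x b y) = g x)
    {F : (ι → G) → ℝ} (hF : Measurable F) {C : ℝ} (hC : ∀ x, |F x| ≤ C) :
    ∫ x, F (Function.update x b (x b * g x)) ∂(Measure.pi fun _ : ι => haarProbability G) =
      ∫ x, F x ∂(Measure.pi fun _ : ι => haarProbability G) := by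
  set μ := haarProbability G with hμ
  have hT := measurable_update_mul_right_of_blind b hg
  have hFT : Measurable fun x : ι → G => F (Function.update x b (x b * g x)) := hF.comp hT
  have hCT : ∀ x : ι → G, |F (Function.update x b (x b * g x))| ≤ C := fun x => hC _
  have hE : condAvg μ {b} (fun x : ι → G => F (Function.update x b (x b * g x))) = condAvg μ {b} F := by
    rw [condAvg_singleton, condAvg_singleton]
    funext x
    have h1 : ∀ y : G, Function.update (Function.update x b y) b (Function.update x b y b * g (Function.update x b y)) =
        Function.update x b (y * g x) := fun y => by
      rw [Function.update_idem, Function.update_self, hblind]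
    simp only [h1]
    exact integral_mul_right_eq_self (μ := μ) (fun y => F (Function.update x b y)) (g x)
  rw [← integral_condAvg {b} hFT hCT, hE, integral_condAvg {b} hF hC]

end Haar

/-- **The femto configuration measure is fibrewise right invariant**: `∫ F(U[e ↦ U e · g(U)]) dU = ∫ F dU` for bounded measurable `F` and
an `e`-blind measurable `g`. [cite: EfronStein1981, §2] -/
theorem integral_configMeasure_comp_update_mul_right {L : ℕ} [NeZero L] (e : Edge 3 L) {g : GaugeConfig 3 L SU2 → SU2}
    (hg : Measurable g) (hblind : ∀ (U : GaugeConfig 3 L SU2) (y : SU2), g (Function.update U e y) = g U)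
    {F : GaugeConfig 3 L SU2 → ℝ} (hF : Measurable F) {C : ℝ} (hC : ∀ U, |F U| ≤ C) :
    ∫ U, F (Function.update U e (U e * g U)) ∂configMeasure SU2 L = ∫ U, F U ∂configMeasure SU2 L := by
  haveI : SecondCountableTopology SU2 := Literature.MathematicalPhysics.QuantumLattice.secondCountableTopology_su2
  unfold configMeasure
  exact integral_comp_update_mul_right_of_blind e hg hblind hF hC

/-! ## §3 The transport flow -/

/-- ★ **`∫ X_e(G) dU = 0` for the transport flow.**  For a link `e`, an `e`-blind measurable direction field `b : GaugeConfig → ℝ³`, and a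
bounded measurable `G` whose restriction to every flow line `t ↦ G(U[e ↦ U e · expPauli(t·b(U))])` is differentiable at `0` with difference
quotients uniformly bounded by `M`: `∫ deriv(t ↦ G(U[e ↦ U e·expPauli(t·b U)])) 0 dU = 0`. [cite: ReedSimonIV1978, Thm. XIII.1] -/
theorem integral_deriv_flow_eq_zero {L : ℕ} [NeZero L] (e : Edge 3 L) {b : GaugeConfig 3 L SU2 → EuclideanSpace ℝ (Fin 3)}
    (hb : Measurable b) (hblind : ∀ (U : GaugeConfig 3 L SU2) (y : SU2), b (Function.update U e y) = b U)
    {G : GaugeConfig 3 L SU2 → ℝ} (hG : Measurable G) {C : ℝ} (hC : ∀ U, |G U| ≤ C) {M : ℝ}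
    (hLip : ∀ (t : ℝ) (U : GaugeConfig 3 L SU2), |G (Function.update U e (U e * expPauli (t • b U))) - G U| ≤ M * |t|)
    (hd : ∀ U : GaugeConfig 3 L SU2, DifferentiableAt ℝ (fun t : ℝ => G (Function.update U e (U e * expPauli (t • b U)))) 0) :
    ∫ U, deriv (fun t : ℝ => G (Function.update U e (U e * expPauli (t • b U)))) 0 ∂configMeasure SU2 L = 0 := by
  have h0 : ∀ U : GaugeConfig 3 L SU2, G (Function.update U e (U e * expPauli ((0 : ℝ) • b U))) = G U := fun U => by
    rw [zero_smul, Literature.MathematicalPhysics.QuantumFieldTheory.Balaban1983to89.B10Eq18SigmaSU2Haar.expPauli_zero, mul_one,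
      Function.update_eq_self]
  refine integral_deriv_eq_zero_of_invariant (configMeasure SU2 L)
    (H := fun t U => G (Function.update U e (U e * expPauli (t • b U)))) (C := C) (M := M) ?_ ?_ (fun t U => hC _) ?_ hd
  · intro t
    have hgt : Measurable fun U : GaugeConfig 3 L SU2 => expPauli (t • b U) := measurable_expPauli.comp (hb.const_smul t)
    have h := integral_configMeasure_comp_update_mul_right e hgt (fun U y => by simp only [hblind]) hG hC
    simp only [h0]
    exact h
  · intro t
    haveI : SecondCountableTopology SU2 := Literature.MathematicalPhysics.QuantumLattice.secondCountableTopology_su2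
    exact hG.comp (measurable_update_mul_right_of_blind e (measurable_expPauli.comp (hb.const_smul t)))
  · intro t U
    have := hLip t U
    simp only [h0]
    exact this

end Summit.QuantumFields.YangMills.Theorems.TransportField

end
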